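import Summits.Ventures.DiscreteObjects.PP12.FlagTenConjunctR3Fin
import Summits.Ventures.DiscreteObjects.PP12.FlagTenConjunctC4

/-!
# `IsFlagTenOrbitMatrix` for the data of a plane: conjunct 10 ((C4), two T-point orbits on different fixed lines) (kernel; Step E transport)
Framing: lottery ticket; floor = certified bounds/negative ranges.

Cell pub-namedobj (venture DiscreteObjects), target (M), designs gen 13 (HOME FAMILY-FLAG7X §7b). For `D = flagTenDataOfPlane …`:
`∀ j ≠ j', ∀ t t', #{i : D.γ j i = t ∧ D.γ j' i = t'} + #{(k,s) : D.β k j s = t ∧ D.β k j' s = t'} = 3`, transported from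
`FlagTenConjunctC4.tpoint_pair_count`; for each `k` the orbit `s` with `β k j s = t` is the orbit of the line `w·y_k` (`w` a point of the orbit `t` on `m_j`).
No `sorry`, no new axioms.
-/

namespace Summit.Ventures.DiscreteObjects.PP12

open Configuration Finset
open scoped Classical

namespace Collineation

variable {P L : Type*} [Membership P L] [ProjectivePlane P L] [Fintype P] [Fintype L] (σ : Collineation P L)

section Data

variable {l : L} {c : P} (hl : σ.onLines l = l) (hc : σ.onPoints c = c) (hcl : c ∈ l)
  (hP : ∀ p : P, σ.onPoints p = p → p ∈ l) (hL : ∀ m : L, σ.onLines m = m → c ∈ m) (h12 : ProjectivePlane.order P L = 12)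
  (hq : σ.onPoints ^ 3 = 1) (hf : fixedCard σ.onPoints = 10) {u₀ : L} (hcu₀ : c ∈ u₀) (hu₀ : σ.onLines u₀ ≠ u₀)

/-- Transport of a count along `eFixP`. -/
theorem card_filter_eFixP (p : P → Prop) :
    (univ.filter fun k : Fin 9 => p (σ.eFixP hl hc hf k).1).card = (univ.filter fun y : P => σ.onPoints y = y ∧ y ≠ c ∧ p y).card := by
  set e := σ.eFixP hl hc hf
  refine Finset.card_bij (fun k _ => (e k).1) (fun k hk => ?_) (fun k₁ _ k₂ _ h => ?_) (fun y hy => ?_)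
  · rw [mem_filter] at hk ⊢; exact ⟨mem_univ _, (e k).2.1, (e k).2.2, hk.2⟩
  · exact e.injective (Subtype.ext h)
  · rw [mem_filter] at hy
    refine ⟨e.symm ⟨y, hy.2.1, hy.2.2.1⟩, ?_, ?_⟩
    · rw [mem_filter]; refine ⟨mem_univ _, ?_⟩; rw [Equiv.apply_symm_apply]; exact hy.2.2.2
    · rw [Equiv.apply_symm_apply]

set_option maxHeartbeats 400000 in
/-- **Conjunct 10 ((C4)).** -/
theorem flagTenDataOfPlane_C4 (j j' : Fin 9) (t t' : Fin 4) (hjj' : j ≠ j') :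
    (univ.filter fun i : Fin 12 => (σ.flagTenDataOfPlane hl hc hcl hP hL h12 hq hf hcu₀ hu₀).γ j i = t ∧
        (σ.flagTenDataOfPlane hl hc hcl hP hL h12 hq hf hcu₀ hu₀).γ j' i = t').card
      + (univ.filter fun p : Fin 9 × Fin 4 => (σ.flagTenDataOfPlane hl hc hcl hP hL h12 hq hf hcu₀ hu₀).β p.1 j p.2 = t ∧
          (σ.flagTenDataOfPlane hl hc hcl hP hL h12 hq hf hcu₀ hu₀).β p.1 j' p.2 = t').card = 3 := by
  set D := σ.flagTenDataOfPlane hl hc hcl hP hL h12 hq hf hcu₀ hu₀ with hD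
  set e := eTri (P := P) h12 hcu₀ with he
  set eK := σ.eFixP hl hc hf with heK
  set m := σ.eFixL hl hc hf j with hm
  set m' := σ.eFixL hl hc hf j' with hm'
  set eO := σ.eOrbOn hc hcl hP hL h12 hq m with heO
  set eO' := σ.eOrbOn hc hcl hP hL h12 hq m' with heO'
  have hmm' : m.1 ≠ m'.1 := fun h => hjj' ((σ.eFixL hl hc hf).injective (Subtype.ext h))
  -- representatives w, w' of the orbits t, t'
  obtain ⟨w, hw, hweq⟩ := mem_image.1 (eO t).2
  obtain ⟨w', hw', hw'eq⟩ := mem_image.1 (eO' t').2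
  rw [mem_filter] at hw hw'
  obtain ⟨-, hwm, hwc⟩ := hw
  obtain ⟨-, hw'm', hw'c⟩ := hw'
  have hwf : σ.onPoints w ≠ w := fun ef => hwc ((Nondegenerate.eq_or_eq hwm (hL m.1 m.2.1) (hP w ef) hcl).resolve_right m.2.2)
  -- unfold γ and β
  have hγ : ∀ (jj : Fin 9) (i : Fin 12), D.γ jj i = (σ.eOrbOn hc hcl hP hL h12 hq (σ.eFixL hl hc hf jj)).symm
      ⟨σ.gammaOrb l c (σ.eFixL hl hc hf jj).1 (e i).1,
        (σ.gammaOrb_mem hl hc hP hL (σ.exterior_of_mem_cline hL hcu₀ hu₀ (e i).2.1 (e i).2.2) (σ.eFixL hl hc hf jj).2.1).1⟩ :=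
    fun jj i => rfl
  have hβ : ∀ (jj : Fin 9) (kk : Fin 9) (tt : Fin 4), D.β kk jj tt = (σ.eOrbOn hc hcl hP hL h12 hq (σ.eFixL hl hc hf jj)).symm
      ⟨σ.betaOrb c (σ.eFixL hl hc hf jj).1 ((σ.eLOrb hl hcl hP hL h12 hq (eK kk)) tt).1, by
          obtain ⟨b₁, hb₁, hb₁eq⟩ := mem_image.1 ((σ.eLOrb hl hcl hP hL h12 hq (eK kk)) tt).2
          rw [mem_filter] at hb₁
          rw [← hb₁eq]
          exact σ.betaOrb_mem hc hcl hP hL hq (eK kk).2.1 (eK kk).2.2 hb₁.2.1 hb₁.2.2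
            (σ.eFixL hl hc hf jj).2.1 (σ.eFixL hl hc hf jj).2.2⟩ := fun jj kk tt => rfl
  -- first filter
  have hset1 : (univ.filter fun i : Fin 12 => D.γ j i = t ∧ D.γ j' i = t')
      = univ.filter fun i : Fin 12 => σ.gammaOrb l c m.1 (e i).1 = orb3 σ.onPoints w ∧ σ.gammaOrb l c m'.1 (e i).1 = orb3 σ.onPoints w' := by
    ext i; simp only [mem_filter, mem_univ, true_and, hγ]
    rw [← hm, ← hm', ← heO, ← heO']
    constructor
    · rintro ⟨h1, h2⟩
      constructor
      · have := congrArg (fun s => (eO s).1) h1; simp at this; rw [this, hweq]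
      · have := congrArg (fun s => (eO' s).1) h2; simp at this; rw [this, hw'eq]
    · rintro ⟨h1, h2⟩
      constructor
      · apply eO.injective; rw [Equiv.apply_symm_apply]; apply Subtype.ext
        change σ.gammaOrb l c m.1 (e i).1 = (eO t).1; rw [h1, hweq]
      · apply eO'.injective; rw [Equiv.apply_symm_apply]; apply Subtype.ext
        change σ.gammaOrb l c m'.1 (e i).1 = (eO' t').1; rw [h2, hw'eq]
  -- the line orbit through y_k meeting m in orb3 w is the orbit of w·y_k
  have hBw : ∀ (kk : Fin 9) (tt : Fin 4), σ.betaOrb c m.1 ((σ.eLOrb hl hcl hP hL h12 hq (eK kk)) tt).1 = orb3 σ.onPoints w ↔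
      ((σ.eLOrb hl hcl hP hL h12 hq (eK kk)) tt).1 = orb3 σ.onLines (lineThrough l w (eK kk).1) := by
    intro kk tt
    set y := eK kk with hy
    obtain ⟨b, hb, hbeq⟩ := mem_image.1 ((σ.eLOrb hl hcl hP hL h12 hq y) tt).2
    rw [mem_filter] at hb
    rw [← hbeq]
    have hwy : w ≠ y.1 := fun ef => hwf (by rw [ef, y.2.1])
    obtain ⟨hwk, hyk⟩ := lineThrough_spec l hwy
    have hkl : lineThrough l w y.1 ≠ l := fun ef => (fun h : w ∈ l => hwc ((Nondegenerate.eq_or_eq hwm (hL m.1 m.2.1) h hcl).resolve_right m.2.2)) (ef ▸ hwk)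
    constructor
    · intro hβw
      -- betaOrb m (orb3 b) = orb3 (b ∩ m) = orb3 w ⇒ the T-line through y in orb3 b through w is w·y ⇒ equal orbits
      have hwk' : w ∈ lineThrough l w y.1 := hwk
      -- both b and w·y are T-lines through y whose points on m lie in one orbit: betaOrb_injective
      symm
      apply σ.betaOrb_injective hc hcl hP hL hq y.2.1 y.2.2 m.2.1 m.2.2 hb.2.1 hb.2.2 hyk hkl
      rw [hβw]
      have hck : c ∉ lineThrough l w y.1 := σ.c_not_mem_tline hcl hP y.2.1 y.2.2 hyk hkl
      have hkm : lineThrough l w y.1 ≠ m.1 := fun ef => hck (ef ▸ hL m.1 m.2.1)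
      rw [σ.betaOrb_eq hc hL hq m.2.1 hck (self_mem_orb3 _ _), ← meetPt_eq c hkm hwk hwm]
    · intro hb'
      rw [hb']
      have hck : c ∉ lineThrough l w y.1 := σ.c_not_mem_tline hcl hP y.2.1 y.2.2 hyk hkl
      have hkm : lineThrough l w y.1 ≠ m.1 := fun ef => hck (ef ▸ hL m.1 m.2.1)
      rw [σ.betaOrb_eq hc hL hq m.2.1 hck (self_mem_orb3 _ _), ← meetPt_eq c hkm hwk hwm]
  -- second filter: pairs (k, s) ↔ k with the condition on w·y_k
  have hset2 : (univ.filter fun p : Fin 9 × Fin 4 => D.β p.1 j p.2 = t ∧ D.β p.1 j' p.2 = t').card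
      = (univ.filter fun k : Fin 9 => σ.betaOrb c m'.1 (orb3 σ.onLines (lineThrough l w (eK k).1)) = orb3 σ.onPoints w').card := by
    -- bijection p ↦ p.1
    refine Finset.card_bij (fun p _ => p.1) (fun p hp => ?_) (fun p₁ hp₁ p₂ hp₂ h => ?_) (fun k hk => ?_)
    · rw [mem_filter] at hp ⊢
      obtain ⟨-, h1, h2⟩ := hp
      rw [hβ, ← hm, ← heO] at h1
      rw [hβ, ← hm', ← heO'] at h2
      have h1v := congrArg (fun s => (eO s).1) h1; simp at h1v
      have h2v := congrArg (fun s => (eO' s).1) h2; simp at h2v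
      rw [← hweq] at h1v; rw [← hw'eq] at h2v
      have hB := (hBw p.1 p.2).1 h1v
      refine ⟨mem_univ _, ?_⟩
      rw [← hB]; exact h2v
    · -- injective: for fixed k the orbit s with β k j s = t is unique (β k j is a bijection)
      rw [mem_filter] at hp₁ hp₂
      have hk : p₁.1 = p₂.1 := h
      have hbij := σ.flagTenDataOfPlane_beta_bijective hl hc hcl hP hL h12 hq hf hcu₀ hu₀ p₁.1 j
      have hs : p₁.2 = p₂.2 := by
        apply hbij.1
        change D.β p₁.1 j p₁.2 = D.β p₁.1 j p₂.2
        rw [hp₁.2.1, hk, hp₂.2.1]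
      exact Prod.ext hk hs
    · rw [mem_filter] at hk
      obtain ⟨-, hk⟩ := hk
      -- the orbit s of the line w·y_k through y_k
      set y := eK k with hy
      have hwy : w ≠ y.1 := fun ef => hwf (by rw [ef, y.2.1])
      obtain ⟨hwk, hyk⟩ := lineThrough_spec l hwy
      have hkl : lineThrough l w y.1 ≠ l := fun ef => (fun h : w ∈ l => hwc ((Nondegenerate.eq_or_eq hwm (hL m.1 m.2.1) h hcl).resolve_right m.2.2)) (ef ▸ hwk)
      have hmem : orb3 σ.onLines (lineThrough l w y.1) ∈ (univ.filter fun b : L => y.1 ∈ b ∧ b ≠ l).image (orb3 σ.onLines) :=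
        mem_image.2 ⟨_, mem_filter.2 ⟨mem_univ _, hyk, hkl⟩, rfl⟩
      set s := (σ.eLOrb hl hcl hP hL h12 hq y).symm ⟨_, hmem⟩ with hs
      have hsv : ((σ.eLOrb hl hcl hP hL h12 hq y) s).1 = orb3 σ.onLines (lineThrough l w y.1) := by
        rw [hs, Equiv.apply_symm_apply]
      refine ⟨(k, s), ?_, rfl⟩
      rw [mem_filter]
      refine ⟨mem_univ _, ?_, ?_⟩
      · rw [hβ, ← hm, ← heO]; apply eO.injective; rw [Equiv.apply_symm_apply]; apply Subtype.ext
        change σ.betaOrb c m.1 ((σ.eLOrb hl hcl hP hL h12 hq y) s).1 = (eO t).1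
        rw [← hweq]; exact (hBw k s).2 hsv
      · rw [hβ, ← hm', ← heO']; apply eO'.injective; rw [Equiv.apply_symm_apply]; apply Subtype.ext
        change σ.betaOrb c m'.1 ((σ.eLOrb hl hcl hP hL h12 hq y) s).1 = (eO' t').1
        rw [hsv, ← hw'eq]; exact hk
  rw [hset1, hset2]
  have h1 := card_filter_eTri h12 hcu₀ (fun x => σ.gammaOrb l c m.1 x = orb3 σ.onPoints w ∧ σ.gammaOrb l c m'.1 x = orb3 σ.onPoints w')
  rw [← he] at h1
  have h2 := σ.card_filter_eFixP hl hc hf (fun y => σ.betaOrb c m'.1 (orb3 σ.onLines (lineThrough l w y)) = orb3 σ.onPoints w')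
  rw [← heK] at h2
  have h3 := σ.tpoint_pair_count hl hc hcl hP hL h12 hq hf hcu₀ hu₀ m.2.1 m.2.2 m'.2.1 m'.2.2 hmm' hwm hwc hwf hw'm' hw'c
  have h4 : (univ.filter fun x : P => x ∈ u₀ ∧ x ≠ c ∧ (σ.gammaOrb l c m.1 x = orb3 σ.onPoints w ∧ σ.gammaOrb l c m'.1 x = orb3 σ.onPoints w')).card
      + (univ.filter fun y : P => σ.onPoints y = y ∧ y ≠ c ∧
          σ.betaOrb c m'.1 (orb3 σ.onLines (lineThrough l w y)) = orb3 σ.onPoints w').card = 3 := by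
    convert h3 using 3
  rw [← h4]
  congr 1
  · convert h1 using 2 <;> (ext x; simp only [mem_filter, mem_univ, true_and])
  · convert h2 using 2 <;> (ext x; simp only [mem_filter, mem_univ, true_and])

end Data

end Collineation

end Summit.Ventures.DiscreteObjects.PP12
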